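import Mathlib.MeasureTheory.Integral.DominatedConvergence
import Mathlib.MeasureTheory.Measure.Lebesgue.EqHaar
import Mathlib.Topology.Instances.Matrix
import Mathlib.LinearAlgebra.Matrix.Determinant.Basic
import HarnessLib

/-!
# Dominated convergence for integrals of determinants whose entries converge off the coincidence set

Topic `Literature/Analysis/Matrix`; the measure-theoretic step of the `M → ∞` ("Matsubara UV") limit of
fermionic perturbation theory.  The order-`k` coefficient of a finite-volume perturbation series is an
integral over `k` imaginary times `t ∈ [0, β]^k` of (sums of) DETERMINANTS of free propagators
`g(t_a − t_b)`; in the finite-frequency Grassmann representation the propagators are truncated Matsubara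
sums `g_M`, which converge to `g` boundedly and pointwise EXCEPT at coinciding times `t_a = t_b`, `a ≠ b`
(where the time-ordered propagator jumps; `Literature.MathematicalPhysics.QuantumLattice.
MatsubaraTruncationConvergence`).  Since the coincidence set is Lebesgue-null and a determinant of bounded
entries is bounded, dominated convergence passes to the limit.  PROVED here, for complex matrices indexed by
a finite type `m` and times indexed by `Fin k`:

* `volume_setOf_exists_apply_eq` — the coincidence set `{t : Fin k → ℝ | ∃ a ≠ b, t a = t b}` is null
  (each hyperplane is a strict subspace; cf. `Literature.Analysis.SpecialFunctions.Selberg.volume_setOf_apply_eq`);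
* `norm_det_le_factorial_mul_pow` — `‖det A‖ ≤ |m|! · B^{|m|}` if all entries have norm `≤ B`;
* `tendsto_setIntegral_of_dominated_off_null` — dominated convergence on a set of finite measure for
  continuous, uniformly bounded `F_M` converging off a null set;
* **`tendsto_setIntegral_det`** — if the entries `A_M(t)_{ij}` are continuous in `t`, bounded by `B` on `Q`
  (`volume Q < ∞`) uniformly in `M`, and converge to `A(t)_{ij}` for `t ∈ Q` off a null set `S`, then
  `∫_Q det A_M(t) dt → ∫_Q det A(t) dt`;
* `tendsto_integral_cube_det` — the case `Q = [0, β]^k`, `S` = the coincidence set.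

Everything is proved; no definitions, no named facts.

## Sources

G. Benfatto, A. Giuliani, V. Mastropietro, Ann. Henri Poincaré 7 (2006) 809–898, §2.1 (2.6)–(2.8) ("standard
arguments … show that" the trace is the `M → ∞` limit of the truncated Grassmann integrals)
[`BenfattoGiulianiMastropietro2006`]; the argument itself is folklore (Lebesgue's dominated convergence).
[folklore]
-/

noncomputable section

namespace Literature.Analysis.Matrix

open _root_.MeasureTheory _root_.Matrix Finset Filter Set
open scoped _root_.Topology ENNReal

/-! ### The coincidence set is null -/

/-- **The coincidence set is null**: `volume {t : Fin k → ℝ | ∃ a ≠ b, t a = t b} = 0`. [folklore] -/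
theorem volume_setOf_exists_apply_eq {k : ℕ} :
    volume {t : Fin k → ℝ | ∃ a b : Fin k, a ≠ b ∧ t a = t b} = 0 := by
  have hsub : {t : Fin k → ℝ | ∃ a b : Fin k, a ≠ b ∧ t a = t b} ⊆
      ⋃ p : {p : Fin k × Fin k // p.1 ≠ p.2}, {t : Fin k → ℝ | t p.1.1 = t p.1.2} := by
    intro t ht
    obtain ⟨a, b, hab, h⟩ := ht
    exact mem_iUnion.2 ⟨⟨(a, b), hab⟩, h⟩
  -- each hyperplane `{t a = t b}`, `a ≠ b`, is a strict subspace, hence null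
  -- (cf. `Literature.Analysis.SpecialFunctions.Selberg.volume_setOf_apply_eq`)
  have hplane : ∀ a b : Fin k, a ≠ b → volume {t : Fin k → ℝ | t a = t b} = 0 := by
    intro a b hab
    let f : (Fin k → ℝ) →ₗ[ℝ] ℝ :=
      (LinearMap.proj (R := ℝ) (φ := fun _ : Fin k => ℝ) a) - (LinearMap.proj (R := ℝ) (φ := fun _ : Fin k => ℝ) b)
    have hker : {t : Fin k → ℝ | t a = t b} = (LinearMap.ker f : Set (Fin k → ℝ)) := by
      ext t
      simp only [mem_setOf_eq, SetLike.mem_coe, LinearMap.mem_ker, f, LinearMap.sub_apply,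
        LinearMap.coe_proj, Function.eval, sub_eq_zero]
    have hne : LinearMap.ker f ≠ ⊤ := by
      intro htop
      have hmem : (Pi.single a (1 : ℝ) : Fin k → ℝ) ∈ LinearMap.ker f := by rw [htop]; exact Submodule.mem_top
      rw [LinearMap.mem_ker] at hmem
      simp [f, hab.symm] at hmem
    rw [hker]
    exact Measure.addHaar_submodule volume _ hne
  refine measure_mono_null hsub ?_
  rw [measure_iUnion_null_iff]
  intro p
  exact hplane _ _ p.2

/-! ### A crude determinant bound -/

/-- `‖det A‖ ≤ |m|! · B^{|m|}` if every entry has norm `≤ B` (Leibniz expansion). [folklore] -/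
theorem norm_det_le_factorial_mul_pow {m : Type*} [Fintype m] [DecidableEq m] {A : _root_.Matrix m m ℂ}
    {B : ℝ} (hA : ∀ i j, ‖A i j‖ ≤ B) :
    ‖A.det‖ ≤ (Fintype.card m).factorial * B ^ Fintype.card m := by
  rw [det_apply']
  calc ‖∑ σ : Equiv.Perm m, (Equiv.Perm.sign σ : ℂ) * ∏ i, A (σ i) i‖
      ≤ ∑ σ : Equiv.Perm m, ‖(Equiv.Perm.sign σ : ℂ) * ∏ i, A (σ i) i‖ := norm_sum_le _ _
    _ ≤ ∑ _σ : Equiv.Perm m, B ^ Fintype.card m := by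
        refine Finset.sum_le_sum fun σ _ => ?_
        rw [norm_mul]
        have hsign : ‖(Equiv.Perm.sign σ : ℂ)‖ = 1 := by
          rcases Int.units_eq_one_or (Equiv.Perm.sign σ) with h | h <;> simp [h]
        rw [hsign, one_mul]
        calc ‖∏ i, A (σ i) i‖ ≤ ∏ i, ‖A (σ i) i‖ := norm_prod_le _ _
          _ ≤ ∏ _i : m, B := Finset.prod_le_prod (fun i _ => norm_nonneg _) fun i _ => hA _ _
          _ = B ^ Fintype.card m := by rw [prod_const, card_univ]
    _ = (Fintype.card m).factorial * B ^ Fintype.card m := by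
        rw [sum_const, card_univ, Fintype.card_perm, nsmul_eq_mul]

/-! ### Dominated convergence off a null set -/

/-- **Dominated convergence on a set of finite measure, off a null set**: if the `F_M` are continuous,
uniformly bounded on `Q` (`volume Q < ∞`) and converge to `f` at every point of `Q` outside a null set `S`,
then `∫_Q F_M → ∫_Q f`. [folklore] -/
theorem tendsto_setIntegral_of_dominated_off_null {X : Type*} [MeasurableSpace X] [TopologicalSpace X]
    [OpensMeasurableSpace X] {μ : Measure X} {F : ℕ → X → ℂ} {f : X → ℂ} {Q S : Set X}
    (hQ : μ Q ≠ ∞) (hQm : MeasurableSet Q) (hS : μ S = 0) (hF : ∀ M, Continuous (F M)) {B : ℝ}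
    (hB : ∀ M, ∀ t ∈ Q, ‖F M t‖ ≤ B) (hlim : ∀ t ∈ Q, t ∉ S → Tendsto (fun M => F M t) atTop (𝓝 (f t))) :
    Tendsto (fun M => ∫ t in Q, F M t ∂μ) atTop (𝓝 (∫ t in Q, f t ∂μ)) := by
  haveI : IsFiniteMeasure (μ.restrict Q) := isFiniteMeasure_restrict.2 hQ
  refine tendsto_integral_of_dominated_convergence (fun _ => B) (fun M => (hF M).aestronglyMeasurable)
    (integrable_const B) (fun M => ?_) ?_
  · exact ae_restrict_of_forall_mem hQm (hB M)
  · have hS' : ∀ᵐ t ∂μ, t ∉ S := compl_mem_ae_iff.2 hS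
    have h1 : ∀ᵐ t ∂μ, t ∈ Q → Tendsto (fun M => F M t) atTop (𝓝 (f t)) :=
      hS'.mono fun t ht htQ => hlim t htQ ht
    exact (ae_restrict_iff' hQm).2 h1

/-! ### Determinants -/

/-- **Dominated convergence for integrals of determinants**: entries continuous in `t`, bounded by `B` on `Q`
uniformly in `M`, converging off a null set `S` ⇒ `∫_Q det A_M(t) dt → ∫_Q det A(t) dt`.
[cite: BenfattoGiulianiMastropietro2006, §2.1 (2.6)-(2.8)] -/
theorem tendsto_setIntegral_det {X : Type*} [MeasurableSpace X] [TopologicalSpace X] [OpensMeasurableSpace X]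
    {μ : Measure X} {m : Type*} [Fintype m] [DecidableEq m]
    {A : ℕ → X → _root_.Matrix m m ℂ} {Alim : X → _root_.Matrix m m ℂ} {Q S : Set X}
    (hQ : μ Q ≠ ∞) (hQm : MeasurableSet Q) (hS : μ S = 0)
    (hcont : ∀ M i j, Continuous fun t => A M t i j) {B : ℝ} (hB : ∀ M, ∀ t ∈ Q, ∀ i j, ‖A M t i j‖ ≤ B)
    (hlim : ∀ t ∈ Q, t ∉ S → ∀ i j, Tendsto (fun M => A M t i j) atTop (𝓝 (Alim t i j))) :
    Tendsto (fun M => ∫ t in Q, (A M t).det ∂μ) atTop (𝓝 (∫ t in Q, (Alim t).det ∂μ)) := by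
  refine tendsto_setIntegral_of_dominated_off_null hQ hQm hS (fun M => ?_)
    (B := (Fintype.card m).factorial * B ^ Fintype.card m) (fun M t ht => ?_) fun t ht htS => ?_
  · have hA : Continuous (A M) := continuous_pi fun i => continuous_pi fun j => hcont M i j
    exact hA.matrix_det
  · exact norm_det_le_factorial_mul_pow (hB M t ht)
  · have hmat : Tendsto (fun M => A M t) atTop (𝓝 (Alim t)) :=
      tendsto_pi_nhds.2 fun i => tendsto_pi_nhds.2 fun j => hlim t ht htS i j
    exact ((continuous_id.matrix_det.tendsto (Alim t)).comp hmat)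

/-- The cube `[0, β]^k` has finite volume. [folklore] -/
theorem volume_Icc_cube_ne_top {k : ℕ} (β : ℝ) :
    volume (Set.Icc (0 : Fin k → ℝ) (fun _ => β)) ≠ ∞ := by
  rw [Real.volume_Icc_pi]
  exact ENNReal.prod_ne_top fun i _ => ENNReal.ofReal_ne_top

/-- **The `M → ∞` limit of a perturbative coefficient**: on the time cube `[0, β]^k`, if the entries
`A_M(t)_{ij}` are continuous in `t`, uniformly bounded, and converge for all `t` in the cube with pairwise
distinct coordinates (no coinciding times), then `∫_{[0,β]^k} det A_M → ∫_{[0,β]^k} det A`.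
[cite: BenfattoGiulianiMastropietro2006, §2.1 (2.6)-(2.8)] -/
theorem tendsto_integral_cube_det {k : ℕ} (β : ℝ) {m : Type*} [Fintype m] [DecidableEq m]
    {A : ℕ → (Fin k → ℝ) → _root_.Matrix m m ℂ} {Alim : (Fin k → ℝ) → _root_.Matrix m m ℂ}
    (hcont : ∀ M i j, Continuous fun t => A M t i j) {B : ℝ}
    (hB : ∀ M, ∀ t ∈ Set.Icc (0 : Fin k → ℝ) (fun _ => β), ∀ i j, ‖A M t i j‖ ≤ B)
    (hlim : ∀ t ∈ Set.Icc (0 : Fin k → ℝ) (fun _ => β), (∀ a b : Fin k, a ≠ b → t a ≠ t b) →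
      ∀ i j, Tendsto (fun M => A M t i j) atTop (𝓝 (Alim t i j))) :
    Tendsto (fun M => ∫ t in Set.Icc (0 : Fin k → ℝ) (fun _ => β), (A M t).det) atTop
      (𝓝 (∫ t in Set.Icc (0 : Fin k → ℝ) (fun _ => β), (Alim t).det)) := by
  refine tendsto_setIntegral_det (volume_Icc_cube_ne_top β) measurableSet_Icc volume_setOf_exists_apply_eq
    hcont hB fun t ht htS => hlim t ht fun a b hab h => htS ⟨a, b, hab, h⟩

end Literature.Analysis.Matrix
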